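import Summits.HubbardSuperconductivity.HubbardSuperconductivity.Theses.FixedNodeShadow

/-!
# Crux `FnAnchorOrder` (stmt-HubbardSuperconductivity-2103, route `FixedNodeShadow`, rank 2) —
# BIRTH SKELETON `Lines/birth.lean` (BC3): sign-exact trial family ⟶ sector Perron structure of the
# shadow ⟶ pair order of the POSITIVE Perron amplitude

The crux (the conclusion of `FnAnchorOrder_of_stubs` below, verbatim): there are `U > 0`,
`δ ∈ (0,1/2)`, a real trial family `φ_L : Finset (Orb Λ_L) → ℝ`, `a > 0` and `L₀` such that for every even
`L ≥ L₀` with `N = N_L = 2⌊(1-δ)L²/2⌋`: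
(i) `φ_L ≠ 0` on the `(N, S^z = 0)` configuration class, (ii) `φ_L = 0` off it,
(ii') TRIAL ORDER `a·L⁴·Σ_s φ_L(s)² ≤ Re⟨φ_L, Δ_d†Δ_d φ_L⟩`, and
(iii) SHADOW ORDER: every normalised `(N,0)`-sector ground state `ψ` of the lattice fixed-node matrix
`F = FN(hubbardTorus 2 L 1 U, φ_L)` (inline; definitionally `fixedNodeMatrix H φ_L` of
`Literature/MathematicalPhysics/QuantumLattice/FixedNode.lean`) has `a·L⁴ ≤ Re⟨ψ, Δ_d†Δ_d ψ⟩`.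

THE LINE (three named stubs + a sorry-free composition) is the route header's own layer-2 reading of
the anchor ("shadow order = sign structure by theorem × amplitude problem for a positive vector"),
guarded as the route-review refuter advised ("in practice prove Anchor for a φ satisfying FnTrialState":
without a connected good-hop graph the sector ground state of `F` may be degenerate across components and
superpositions can cancel the cross terms of `⟨Δ†Δ⟩`):

* `stub_trialState` (OPEN, = the route's rank-4 crux `FnTrialState` BY NAME, L–XL): a SIGN-EXACT
  ADMISSIBLE d-WAVE TRIAL FAMILY exists — `δ ∈ (0,1/2)`, `φ`, `a > 0` with, eventually in even `L`:
  admissible (i), sector-supported (ii), CONNECTED GOOD-HOP GRAPH on the class for every `U` (the hopping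
  signs of `hubbardTorus 2 L 1 U` are `U`-independent), and trial d-wave order (ii'). Intended witness:
  a generic admissible real lift of the Gutzwiller × number-projected `d_{x²-y²}` BCS state
  (`Literature.MathematicalPhysics.QuantumLattice.projectedBCSState`, Anderson1987 /
  ZhangGrosRiceShiba1988 / ParamekantiRanderiaTrivedi2004). Why it might fail: pure d-wave
  determinants have symmetry-forced exact zeros and sign-erratic low-`|φ|` regions that can cut the good
  graph (no lattice tiling theorem, cf. Ceperley1991); `L⁴` pair LRO of projected dBCS is itself open.
* `stub_sectorPerron` (PROVABLE NOW from the tree, M): SIGN-EXACTNESS OF THE SHADOW IN THE SECTOR — for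
  every side `L`, filling `N`, coupling `U` and every real `φ_L` that is nowhere zero on the `(N,0)` class
  and whose good-hop graph `{Re H_{bc}·φ_L(b)φ_L(c) < 0}` is connected on the class, EVERY `(N,0)`-sector
  ground state `ψ` of `F = FN(H, φ_L)`, `H = hubbardTorus 2 L 1 U`, is `c • (sgn φ_L · r)` with an
  amplitude `r` that is `> 0` on the class and `0` off it. This is the sector reindexing of the route's
  PROVED support item `FnSignedPerron` (`Theorems/FixedNodeShadowFnSignedPerron.lean`, from
  `fixedNodeMatrix_groundState_pos_signed`): `H` conserves `N` and `S^z`, so `H` and `F` are block-diagonal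
  in the occupation basis, the `(N,0)` block of `F` is `FN(H|class, φ_L|class)`, a sector ground state is a
  ground vector of that block (`Matrix.minEnergyOn (szSector N 0)` = its lowest eigenvalue), and
  Perron–Frobenius applies to the block in the signed basis. Sources: TenhaafEtAl1995, LiebWuPhysicaA2003 §2,
  GubernatisKawashimaWerner2016 §11.2, BeccaSorella2017 §10.4.
* `stub_perronAmplitudeOrder` (OPEN CORE, XL — "the amplitude problem"): for every sign-exact admissible
  d-wave trial family `(δ, φ, a)` (the body of `FnTrialState`) there are a coupling `U > 0`, `a' > 0` and
  `L₁` such that for every even `L ≥ L₁`, every normalised `(N_L,0)`-sector ground state `ψ` of the shadow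
  `F = FN(hubbardTorus 2 L 1 U, φ_L)` THAT HAS THE PERRON FORM `ψ = c • (sgn φ_L · r)`, `r > 0` on the
  class, carries d-wave pair order `a'·L⁴ ≤ Re⟨ψ, Δ_d†Δ_d ψ⟩`. With the sign structure handed over by
  theorem, this is a statement about ONE entrywise-positive vector `r` (the principal eigenvector of the
  Doob-transformed operator `−L + E_loc` on the good-hop graph, `L` the `φ²`-reversible jump generator with
  rates `|H_{ss'}|φ(s')/φ(s)`, `E_loc = (Hφ)/φ` the VMC local energy) against the signed pair kernel
  `M_{ss'} = sgn φ(s) sgn φ(s') Re (Δ_d†Δ_d)_{ss'}`: `Σ_{s,s'} r(s) r(s') M_{ss'} ≥ a' L⁴` — positivity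
  mathematics (Feynman–Kac / Dirichlet forms / Harnack-type comparison of `r` with `|φ|` under pair moves),
  not a sign problem. Why it might fail: it is typed UNIVERSALLY in `φ` (so that the composition is pure
  logic, exactly as the route typed `FnNodeRelease`): an adversarial admissible family whose `φ²`-weight
  (and order) sits on an energetically poor region while a vast low-`|φ|` region hosts the shadow's Perron
  weight would falsify it — the repair is then to carry the side condition the refutation reveals (small
  `φ²`-variance of `E_loc`, or the named Gutzwiller–dBCS family) into `stub_trialState`, not to abandon the
  line; and, honestly, `U(1)`-breaking ground-state order in `d = 2` has so far been proved only via
  reflection positivity (KLS1988PRL; LiebSeiringerSolovejYngvason2005 ch. 11), which `F` lacks. Sources: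
  TenhaafEtAl1995, GubernatisKawashimaWerner2016 p. 383 (the `|ψ_T|`-dependence of the lattice FN state via
  `V_sf`), SorellaEtAl2002 (d-wave order at the FN end of the 2D t–J model, numerics), AizenmanEtAl2004.
* `FnAnchorOrder_of_stubs` (sorry-free, pure logic + `min`/`max` arithmetic): take `(δ, φ, a, L₀)` from
  `stub_trialState`, feed its body to `stub_perronAmplitudeOrder` to get `(U, a', L₁)`; the crux holds with
  `U`, `δ`, `φ`, `a* := min a a'`, `L* := max L₀ L₁`: (i), (ii) verbatim; (ii') because `a* ≤ a` and
  `L⁴ Σ φ² ≥ 0`; (iii) because a normalised sector ground state of `F` has the Perron form by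
  `stub_sectorPerron` (connectivity from `stub_trialState` at this `U`), so `stub_perronAmplitudeOrder`
  gives `a' L⁴ ≤ Re⟨ψ, Δ†Δ ψ⟩` and `a* ≤ a'`. `FnAnchorOrder_of` is the crux BY NAME from the three stubs
  (sorry only inside `stub_*`).

Disproof used: none exists for this crux (`ledger crux ls stmt-HubbardSuperconductivity-2103`: no workfiles,
2026-08-17); the summit negatives index (stmt-1180 `not_breathingSelfDual`, stmt-1314
`AposterioriCapRgKlsOrderOpenness_refuted`) concerns other statements and no stub is an instance of either.
Dead lines: none recorded for this crux.
-/

noncomputable section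

set_option linter.dupNamespace false

namespace Summit.HubbardSuperconductivity.HubbardSuperconductivity.Cruxes.FnAnchorOrder.Birth

open scoped BigOperators Topology Manifold Classical MeasureTheory ProbabilityTheory Matrix InnerProductSpace ComplexConjugate ContinuousMap
open Filter Set Function TopologicalSpace MeasureTheory
open Literature.Hubbard
open Literature.MathematicalPhysics.QuantumLattice
open Summit.HubbardSuperconductivity.HubbardSuperconductivity.Theses.FixedNodeShadow

/-! ## Stubs -/

/-- STUB 1 (OPEN — the route's rank-4 crux `FnTrialState`, by name): a SIGN-EXACT ADMISSIBLE d-WAVE TRIAL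
FAMILY. `∃ δ ∈ (0,1/2), φ, a > 0, L₀` such that for every even `L ≥ L₀` with `N = N_L`: (i) `φ_L ≠ 0` on the
`(N, S^z=0)` class; (ii) `φ_L = 0` off it; (iii) for every `U`, any two class configurations are joined by a
chain of GOOD hops of `hubbardTorus 2 L 1 U` (`Re H_{bc}·φ_L(b)φ_L(c) < 0`); (iv) trial d-wave order
`a·L⁴·Σ_s φ_L(s)² ≤ Re⟨φ_L, Δ_d†Δ_d φ_L⟩`. Intended witness: a generic admissible real lift of the
Gutzwiller × number-projected d-wave BCS state (`projectedBCSState`).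
[Anderson1987; ZhangGrosRiceShiba1988; ParamekantiRanderiaTrivedi2004, §IV; TenhaafEtAl1995; Ceperley1991] -/
theorem stub_trialState : FnTrialState := by
  sorry

/-- STUB 2 (PROVABLE NOW — sector sign-exactness of the shadow; the sector reindexing of the route's proved
support item `FnSignedPerron`). For every side `L`, filling `N`, coupling `U` and real `φL` nowhere zero on
the `(N, S^z = 0)` configuration class whose good-hop graph is connected on the class, every `(N,0)`-sector
ground state `ψ` of the fixed-node matrix `F = FN(hubbardTorus 2 L 1 U, φL)` (inline; definitionally
`fixedNodeMatrix H φL`) is a complex multiple of `sgn φL · r` with `r > 0` on the class and `r = 0` off it: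
`H` conserves `N` and `S^z`, so `F` is block-diagonal in the occupation basis, its `(N,0)` block is
`FN(H|class, φL|class)`, a sector ground state is a ground vector of the block, and
`fixedNodeMatrix_groundState_pos_signed` (Perron–Frobenius in the signed basis) applies to the block.
[TenhaafEtAl1995; LiebWuPhysicaA2003, §2; GubernatisKawashimaWerner2016, §11.2; BeccaSorella2017, §10.4] -/
theorem stub_sectorPerron :
    ∀ (L : ℕ) [NeZero L] (N : ℕ) (U : ℝ) (φL : Finset (Orb (FermionTorus 2 L)) → ℝ),
      (∀ s, (s.card = N ∧ 2 * (s.filter (fun o => (ofLex o).2 = 0)).card = N) → φL s ≠ 0) →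
        ∀ H, H = hubbardTorus 2 L 1 U →
          (∀ s s', (s.card = N ∧ 2 * (s.filter (fun o => (ofLex o).2 = 0)).card = N) →
              (s'.card = N ∧ 2 * (s'.filter (fun o => (ofLex o).2 = 0)).card = N) →
                Relation.ReflTransGen (fun b c => (H b c).re * φL b * φL c < 0) s s') →
            ∀ F, F = Matrix.of (fun s s' => if s = s' then H s s + ∑ s'', (if s'' ≠ s ∧
                0 < (H s s'').re * φL s * φL s'' then ((((H s s'').re * φL s'' / φL s : ℝ)) : ℂ) else 0)
                else (if 0 < (H s s').re * φL s * φL s' then 0 else H s s')) →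
              ∀ ψ, IsGroundStateInSector F N 0 ψ →
                ∃ (c : ℂ) (r : Finset (Orb (FermionTorus 2 L)) → ℝ),
                  (∀ s, (s.card = N ∧ 2 * (s.filter (fun o => (ofLex o).2 = 0)).card = N) → 0 < r s) ∧
                    (∀ s, ¬ (s.card = N ∧ 2 * (s.filter (fun o => (ofLex o).2 = 0)).card = N) → r s = 0) ∧
                      ψ = c • (fun s => (((Real.sign (φL s) * r s : ℝ)) : ℂ)) := by
  sorry

/-- STUB 3 (OPEN CORE — the amplitude problem: the POSITIVE Perron amplitude of the shadow keeps the trial's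
d-wave pair coherence). For every sign-exact admissible d-wave trial family `(δ, φ, a)` (the body of
`FnTrialState`: admissible, sector-supported, connected good-hop graph for every `U`, trial order) there are
`U > 0`, `a' > 0`, `L₁` such that for every even `L ≥ L₁` with `N = N_L`, every normalised `(N,0)`-sector
ground state `ψ` of `F = FN(hubbardTorus 2 L 1 U, φ_L)` OF PERRON FORM `ψ = c • (sgn φ_L · r)` (`r > 0` on
the class, `0` off it) has `a'·L⁴ ≤ Re⟨ψ, Δ_d†Δ_d ψ⟩`, `Δ_d = pairField dWaveFormFactor L`. In the `φ`-gauge: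
`Σ_{s,s'} r(s) r(s') · sgn φ(s) sgn φ(s') Re(Δ_d†Δ_d)_{ss'} ≥ a' L⁴` for the principal eigenvector `r/|φ|` of
the Doob-transformed operator `−L + E_loc` on the good-hop graph — positivity mathematics, not a sign
problem. Typed universally in `φ` (as the route typed `FnNodeRelease`) so that the composition is logic; an
adversarial-`φ` refutation is answered by moving the revealed side condition into `stub_trialState`.
[TenhaafEtAl1995; GubernatisKawashimaWerner2016, §11.4 p. 383; SorellaEtAl2002; KLS1988PRL;
LiebSeiringerSolovejYngvason2005, ch. 11; AizenmanEtAl2004] -/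
theorem stub_perronAmplitudeOrder :
    ∀ (δ : ℝ) (φ : (∀ L : ℕ, Finset (Orb (FermionTorus 2 L)) → ℝ)) (a : ℝ),
      δ ∈ Set.Ioo (0:ℝ) (1/2) → 0 < a →
        (∃ L₀ : ℕ, ∀ (L : ℕ) [NeZero L], L₀ ≤ L → Even L → ∀ N : ℕ, N = 2 * ⌊(1 - δ) * (L : ℝ) ^ 2 / 2⌋₊ →
          (∀ s, (s.card = N ∧ 2 * (s.filter (fun o => (ofLex o).2 = 0)).card = N) → φ L s ≠ 0) ∧
          (∀ s, ¬ (s.card = N ∧ 2 * (s.filter (fun o => (ofLex o).2 = 0)).card = N) → φ L s = 0) ∧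
          (∀ U : ℝ, ∀ H, H = hubbardTorus 2 L 1 U → ∀ s s',
            (s.card = N ∧ 2 * (s.filter (fun o => (ofLex o).2 = 0)).card = N) →
            (s'.card = N ∧ 2 * (s'.filter (fun o => (ofLex o).2 = 0)).card = N) →
              Relation.ReflTransGen (fun b c => (H b c).re * φ L b * φ L c < 0) s s') ∧
          a * (L : ℝ) ^ 4 * (∑ s, (φ L s) ^ 2) ≤
            (expect ((pairField dWaveFormFactor L)ᴴ * pairField dWaveFormFactor L)
              (fun s => ((φ L s : ℝ) : ℂ))).re) →
        ∃ U : ℝ, 0 < U ∧ ∃ a' : ℝ, 0 < a' ∧ ∃ L₁ : ℕ, ∀ (L : ℕ) [NeZero L], L₁ ≤ L → Even L →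
          ∀ N : ℕ, N = 2 * ⌊(1 - δ) * (L : ℝ) ^ 2 / 2⌋₊ →
            ∀ H, H = hubbardTorus 2 L 1 U →
              ∀ F, F = Matrix.of (fun s s' => if s = s' then H s s + ∑ s'', (if s'' ≠ s ∧
                  0 < (H s s'').re * φ L s * φ L s'' then ((((H s s'').re * φ L s'' / φ L s : ℝ)) : ℂ) else 0)
                  else (if 0 < (H s s').re * φ L s * φ L s' then 0 else H s s')) →
                ∀ ψ, star ψ ⬝ᵥ ψ = 1 → IsGroundStateInSector F N 0 ψ →
                  (∃ (c : ℂ) (r : Finset (Orb (FermionTorus 2 L)) → ℝ),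
                    (∀ s, (s.card = N ∧ 2 * (s.filter (fun o => (ofLex o).2 = 0)).card = N) → 0 < r s) ∧
                      (∀ s, ¬ (s.card = N ∧ 2 * (s.filter (fun o => (ofLex o).2 = 0)).card = N) → r s = 0) ∧
                        ψ = c • (fun s => (((Real.sign (φ L s) * r s : ℝ)) : ℂ))) →
                  a' * (L : ℝ) ^ 4 ≤
                    (expect ((pairField dWaveFormFactor L)ᴴ * pairField dWaveFormFactor L) ψ).re := by
  sorry

/-! ## Composition -/

/-- COMPOSITION, hypothesis form (sorry-free): Stub 1 → Stub 2 → Stub 3 → the body of the crux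
`Theses.FixedNodeShadow.FnAnchorOrder` VERBATIM (spelled out, so that `FnAnchorOrder_of` below is the unique
theorem of this file concluding the crux by name). Proof: `(δ, φ, a, L₀)` from Stub 1; `(U, a', L₁)` from
Stub 3 fed with Stub 1's body; witnesses `U, δ, φ, min a a', max L₀ L₁`; (i), (ii) verbatim; (ii') by
`min a a' ≤ a` and `0 ≤ L⁴ Σ φ²`; (iii): a normalised sector ground state of `F` has the Perron form by Stub 2
(admissibility and connectivity at this `U` from Stub 1), so Stub 3 applies, and `min a a' ≤ a'`. [folklore] -/
theorem FnAnchorOrder_of_stubs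
    (h1 : FnTrialState)
    (h2 : ∀ (L : ℕ) [NeZero L] (N : ℕ) (U : ℝ) (φL : Finset (Orb (FermionTorus 2 L)) → ℝ),
      (∀ s, (s.card = N ∧ 2 * (s.filter (fun o => (ofLex o).2 = 0)).card = N) → φL s ≠ 0) →
        ∀ H, H = hubbardTorus 2 L 1 U →
          (∀ s s', (s.card = N ∧ 2 * (s.filter (fun o => (ofLex o).2 = 0)).card = N) →
              (s'.card = N ∧ 2 * (s'.filter (fun o => (ofLex o).2 = 0)).card = N) →
                Relation.ReflTransGen (fun b c => (H b c).re * φL b * φL c < 0) s s') →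
            ∀ F, F = Matrix.of (fun s s' => if s = s' then H s s + ∑ s'', (if s'' ≠ s ∧
                0 < (H s s'').re * φL s * φL s'' then ((((H s s'').re * φL s'' / φL s : ℝ)) : ℂ) else 0)
                else (if 0 < (H s s').re * φL s * φL s' then 0 else H s s')) →
              ∀ ψ, IsGroundStateInSector F N 0 ψ →
                ∃ (c : ℂ) (r : Finset (Orb (FermionTorus 2 L)) → ℝ),
                  (∀ s, (s.card = N ∧ 2 * (s.filter (fun o => (ofLex o).2 = 0)).card = N) → 0 < r s) ∧
                    (∀ s, ¬ (s.card = N ∧ 2 * (s.filter (fun o => (ofLex o).2 = 0)).card = N) → r s = 0) ∧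
                      ψ = c • (fun s => (((Real.sign (φL s) * r s : ℝ)) : ℂ)))
    (h3 : ∀ (δ : ℝ) (φ : (∀ L : ℕ, Finset (Orb (FermionTorus 2 L)) → ℝ)) (a : ℝ),
      δ ∈ Set.Ioo (0:ℝ) (1/2) → 0 < a →
        (∃ L₀ : ℕ, ∀ (L : ℕ) [NeZero L], L₀ ≤ L → Even L → ∀ N : ℕ, N = 2 * ⌊(1 - δ) * (L : ℝ) ^ 2 / 2⌋₊ →
          (∀ s, (s.card = N ∧ 2 * (s.filter (fun o => (ofLex o).2 = 0)).card = N) → φ L s ≠ 0) ∧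
          (∀ s, ¬ (s.card = N ∧ 2 * (s.filter (fun o => (ofLex o).2 = 0)).card = N) → φ L s = 0) ∧
          (∀ U : ℝ, ∀ H, H = hubbardTorus 2 L 1 U → ∀ s s',
            (s.card = N ∧ 2 * (s.filter (fun o => (ofLex o).2 = 0)).card = N) →
            (s'.card = N ∧ 2 * (s'.filter (fun o => (ofLex o).2 = 0)).card = N) →
              Relation.ReflTransGen (fun b c => (H b c).re * φ L b * φ L c < 0) s s') ∧
          a * (L : ℝ) ^ 4 * (∑ s, (φ L s) ^ 2) ≤
            (expect ((pairField dWaveFormFactor L)ᴴ * pairField dWaveFormFactor L)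
              (fun s => ((φ L s : ℝ) : ℂ))).re) →
        ∃ U : ℝ, 0 < U ∧ ∃ a' : ℝ, 0 < a' ∧ ∃ L₁ : ℕ, ∀ (L : ℕ) [NeZero L], L₁ ≤ L → Even L →
          ∀ N : ℕ, N = 2 * ⌊(1 - δ) * (L : ℝ) ^ 2 / 2⌋₊ →
            ∀ H, H = hubbardTorus 2 L 1 U →
              ∀ F, F = Matrix.of (fun s s' => if s = s' then H s s + ∑ s'', (if s'' ≠ s ∧
                  0 < (H s s'').re * φ L s * φ L s'' then ((((H s s'').re * φ L s'' / φ L s : ℝ)) : ℂ) else 0)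
                  else (if 0 < (H s s').re * φ L s * φ L s' then 0 else H s s')) →
                ∀ ψ, star ψ ⬝ᵥ ψ = 1 → IsGroundStateInSector F N 0 ψ →
                  (∃ (c : ℂ) (r : Finset (Orb (FermionTorus 2 L)) → ℝ),
                    (∀ s, (s.card = N ∧ 2 * (s.filter (fun o => (ofLex o).2 = 0)).card = N) → 0 < r s) ∧
                      (∀ s, ¬ (s.card = N ∧ 2 * (s.filter (fun o => (ofLex o).2 = 0)).card = N) → r s = 0) ∧
                        ψ = c • (fun s => (((Real.sign (φ L s) * r s : ℝ)) : ℂ))) →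
                  a' * (L : ℝ) ^ 4 ≤
                    (expect ((pairField dWaveFormFactor L)ᴴ * pairField dWaveFormFactor L) ψ).re) :
    -- the body of `Theses.FixedNodeShadow.FnAnchorOrder`, verbatim:
    ∃ U : ℝ, 0 < U ∧ ∃ δ ∈ Set.Ioo (0:ℝ) (1/2), ∃ φ : (∀ L : ℕ, Finset (Literature.MathematicalPhysics.QuantumLattice.Orb (Literature.MathematicalPhysics.QuantumLattice.FermionTorus 2 L)) → ℝ), ∃ a : ℝ, 0 < a ∧ ∃ L₀ : ℕ, ∀ (L : ℕ) [NeZero L], L₀ ≤ L → Even L → ∀ N : ℕ, N = 2 * ⌊(1 - δ) * (L : ℝ) ^ 2 / 2⌋₊ → (∀ s, (s.card = N ∧ 2 * (s.filter (fun o => (ofLex o).2 = 0)).card = N) → φ L s ≠ 0) ∧ (∀ s, ¬ (s.card = N ∧ 2 * (s.filter (fun o => (ofLex o).2 = 0)).card = N) → φ L s = 0) ∧ a * (L : ℝ) ^ 4 * (∑ s, (φ L s) ^ 2) ≤ (Literature.MathematicalPhysics.QuantumLattice.expect ((Literature.MathematicalPhysics.QuantumLattice.pairField Literature.MathematicalPhysics.QuantumLattice.dWaveFormFactor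 L)ᴴ * Literature.MathematicalPhysics.QuantumLattice.pairField Literature.MathematicalPhysics.QuantumLattice.dWaveFormFactor L) (fun s => ((φ L s : ℝ) : ℂ))).re ∧ (∀ H, H = Literature.MathematicalPhysics.QuantumLattice.hubbardTorus 2 L 1 U → ∀ F, F = Matrix.of (fun s s' => if s = s' then H s s + ∑ s'', (if s'' ≠ s ∧ 0 < (H s s'').re * φ L s * φ L s'' then ((((H s s'').re * φ L s'' / φ L s : ℝ)) : ℂ) else 0) else (if 0 < (H s s').re * φ L s * φ L s' then 0 else H s s')) → ∀ ψ, star ψ ⬝ᵥ ψ = 1 → Literature.MathematicalPhysics.QuantumLattice.IsGroundStateInSector F N 0 ψ → a * (L : ℝ) ^ 4 ≤ (Literature.MathematicalPhysics.QuantumLattice.expect ((Literature.MathematicalPhysics.QuantumLattice.pairField Literature.MathematicalPhysics.QuantumLattice.dWaveFormFactor L)ᴴ * Literature.MathematicalPhysics.QuantumLattice.pairField Literature.MathematicalPhysics.QuantumLattice.dWaveFormFactor L) ψ).re) := by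
  obtain ⟨δ, hδ, φ, a, ha, L₀, hT⟩ := h1
  obtain ⟨U, hU, a', ha', L₁, hS⟩ := h3 δ φ a hδ ha ⟨L₀, hT⟩
  refine ⟨U, hU, δ, hδ, φ, min a a', lt_min ha ha', max L₀ L₁, ?_⟩
  intro L _ hL hE N hN
  obtain ⟨hi, hii, hconn, hiv⟩ := hT L ((le_max_left L₀ L₁).trans hL) hE N hN
  refine ⟨hi, hii, ?_, ?_⟩
  · -- (ii') trial order with the smaller constant `min a a' ≤ a`
    have hnn : 0 ≤ (L : ℝ) ^ 4 * (∑ s, (φ L s) ^ 2) :=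
      mul_nonneg (pow_nonneg (Nat.cast_nonneg L) 4) (Finset.sum_nonneg (fun s _ => sq_nonneg (φ L s)))
    have hmin : min a a' * (L : ℝ) ^ 4 * (∑ s, (φ L s) ^ 2) ≤ a * (L : ℝ) ^ 4 * (∑ s, (φ L s) ^ 2) := by
      rw [mul_assoc, mul_assoc]
      exact mul_le_mul_of_nonneg_right (min_le_left a a') hnn
    exact hmin.trans hiv
  · -- (iii) shadow order: Perron form by Stub 2, order of the positive amplitude by Stub 3
    intro H hH F hF ψ hψ hgs
    have hP := h2 L N U (φ L) hi H hH (hconn U H hH) F hF ψ hgs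
    have hord := hS L ((le_max_right L₀ L₁).trans hL) hE N hN H hH F hF ψ hψ hgs hP
    have hL4 : 0 ≤ (L : ℝ) ^ 4 := pow_nonneg (Nat.cast_nonneg L) 4
    exact (mul_le_mul_of_nonneg_right (min_le_right a a') hL4).trans hord

/-- THE SKELETON THEOREM — the crux `FnAnchorOrder` BY NAME (route `FixedNodeShadow`'s decl; no hypotheses,
no `sorry` of its own): the three registered stubs fed into `FnAnchorOrder_of_stubs`. Its only
non-whitelisted axiom is the `sorryAx` of the stubs; it becomes a proof of the crux the moment the three
stubs are theorems. -/
theorem FnAnchorOrder_of : FnAnchorOrder :=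
  FnAnchorOrder_of_stubs stub_trialState stub_sectorPerron stub_perronAmplitudeOrder

end Summit.HubbardSuperconductivity.HubbardSuperconductivity.Cruxes.FnAnchorOrder.Birth
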